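import Literature.Geometry.Lorentzian.MomentPartition
import HarnessLib

/-!
# Splitting a vector density with vanishing Killing moments (gluing step of Lemma 2.2, divergence equation)

(trunk G08 = T-LORENTZ; family `gr`; namespace `Literature.Geometry.Lorentzian.MaoOhTao`.)

Mao–Oh–Tao (arXiv:2308.13031), proof of Lemma 2.2 (p. 9), last sentence: "The case of `T` is similar."  For the
symmetric divergence equation `∂_i π^{ij} = f^j` the obstructions are the Killing fields `e₁, e₂, e₃, Y₁, Y₂, Y₃` of
`ℝ³` (`(T2)`: `∫ f·(e₁, …, Y₃)† dx = 0`), so the splitting `f = f₁ + f₂` of a vector density between two overlapping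
open sets must preserve the six moments `∫ f·e_l`, `∫ f·Y_l`.  This file is the vector analogue of
`MomentPartition.lean`, indexing the Killing fields by `a ∈ Fin 3 ⊕ Fin 3` (`inl l ↦ e_l`, `inr l ↦ Y_l = rotGen l`):

* `killingFn a x j` — the `j`-th component of the `a`-th Killing field at `x`;
* `gramMatrixK η` — `G_{ab} = ∫ (K_a · K_b) η² dx`, with `dotProduct_gramMatrixK_mulVec` (`vᵀ G v = ∫ |Σ v_a K_a|² η²`),
  `eq_zero_of_killing_eq_zero_on_ball` (a Killing field `c + ω × x` vanishing on a ball is zero),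
  `gramMatrixK_posDef`, `isUnit_gramMatrixK_det`;
* `thetaK η a x j = Σ_b (G⁻¹)_{ab} (K_b)_j(x) η(x)²` — dual bump fields, `integral_thetaK_killingFn` (biorthogonality);
* `momentPartK η F χ j = F_j χ − Σ_a (∫ (Fχ)·K_a) (θ^a)_j` — the moment-corrected localisation, with vanishing Killing
  moments (`integral_momentPartK_killingFn`), support in `supp (Fχ) ∪ supp η`, and
  `momentPartK_add_momentPartK(_of_moments)`, `momentsK_of_momentPartK_add` — `F = F₁ + F₂` iff the moments vanish.

Everything is proved; four definitions, no named facts.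

## References

* Y. Mao, S.-J. Oh, T. Tao, arXiv:2308.13031 (2023), proof of Lemma 2.2, p. 9; Lemma 2.2 (T2) (key `MaoOhTao2023`).
-/

noncomputable section

open scoped RealInnerProductSpace Topology ContDiff Matrix
open Filter MeasureTheory Set Metric Function

namespace Literature.Geometry.Lorentzian

namespace MaoOhTao

/-! ### The Killing fields and their Gram matrix -/

/-- The components of the six Killing fields of `ℝ³`: translations `e_l` (`inl l`) and rotations `Y_l = e_l × x`
(`inr l`, `rotGen`). [cite: MaoOhTao2023, Lemma 2.2 (T2)] -/
def killingFn (a : Fin 3 ⊕ Fin 3) (x : E3) (j : Fin 3) : ℝ :=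
  Sum.elim (fun l ↦ e l j) (fun l ↦ rotGen l x j) a

/-- Translations. [folklore] -/
@[simp] theorem killingFn_inl (l : Fin 3) (x : E3) (j : Fin 3) : killingFn (Sum.inl l) x j = e l j := rfl

/-- Rotations. [folklore] -/
@[simp] theorem killingFn_inr (l : Fin 3) (x : E3) (j : Fin 3) : killingFn (Sum.inr l) x j = rotGen l x j := rfl

/-- The Killing components are smooth in `x`. [folklore] -/
theorem contDiff_killingFn {n : ℕ∞ω} (a : Fin 3 ⊕ Fin 3) (j : Fin 3) : ContDiff ℝ n fun x ↦ killingFn a x j := by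
  cases a with
  | inl l => exact contDiff_const
  | inr l => exact contDiff_rotGen l j

/-- The Killing components are continuous in `x`. [folklore] -/
theorem continuous_killingFn (a : Fin 3 ⊕ Fin 3) (j : Fin 3) : Continuous fun x ↦ killingFn a x j :=
  (contDiff_killingFn (n := 0) a j).continuous

/-- `rotGen` is additive in `x`. [folklore] -/
theorem rotGen_add (l : Fin 3) (x y : E3) (j : Fin 3) : rotGen l (x + y) j = rotGen l x j + rotGen l y j := by
  fin_cases j <;> simp [rotGen] <;> ring

/-- `rotGen` is homogeneous in `x`. [folklore] -/
theorem rotGen_smul (l : Fin 3) (t : ℝ) (x : E3) (j : Fin 3) : rotGen l (t • x) j = t * rotGen l x j := by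
  fin_cases j <;> simp [rotGen] <;> ring

/-- **The Gram matrix** `G_{ab} = ∫ (K_a · K_b) η² dx` of the Killing fields with respect to the weight `η²`.
[cite: MaoOhTao2023, Lemma 2.2 (proof)] -/
def gramMatrixK (η : E3 → ℝ) : Matrix (Fin 3 ⊕ Fin 3) (Fin 3 ⊕ Fin 3) ℝ :=
  Matrix.of fun a b ↦ ∫ x : E3, (∑ j, killingFn a x j * killingFn b x j) * η x ^ 2

/-- Entries of the Gram matrix. [folklore] -/
theorem gramMatrixK_apply (η : E3 → ℝ) (a b : Fin 3 ⊕ Fin 3) :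
    gramMatrixK η a b = ∫ x : E3, (∑ j, killingFn a x j * killingFn b x j) * η x ^ 2 := rfl

/-- The Gram matrix is symmetric. [folklore] -/
theorem gramMatrixK_transpose (η : E3 → ℝ) : (gramMatrixK η)ᵀ = gramMatrixK η := by
  ext a b
  simp only [Matrix.transpose_apply, gramMatrixK_apply]
  congr 1
  funext x
  congr 1
  exact Finset.sum_congr rfl fun j _ ↦ mul_comm _ _

variable {η : E3 → ℝ}

/-- The Gram integrands are integrable for `η ∈ C_c`. [folklore] -/
theorem integrable_killingFn_mul (hη : Continuous η) (hηc : HasCompactSupport η) (a b : Fin 3 ⊕ Fin 3) :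
    Integrable fun x : E3 ↦ (∑ j, killingFn a x j * killingFn b x j) * η x ^ 2 :=
  ((continuous_finsetSum _ fun j _ ↦ (continuous_killingFn a j).mul (continuous_killingFn b j)).mul
    (hη.pow 2)).integrable_of_hasCompactSupport (hasCompactSupport_of_eta hηc fun x hx ↦ by simp [hx])

/-- **The quadratic form of the Gram matrix**: `vᵀ G v = ∫ Σ_j (Σ_a v_a (K_a)_j)² η² dx`. [folklore] -/
theorem dotProduct_gramMatrixK_mulVec (hη : Continuous η) (hηc : HasCompactSupport η) (v : Fin 3 ⊕ Fin 3 → ℝ) :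
    v ⬝ᵥ (gramMatrixK η *ᵥ v) = ∫ x : E3, (∑ j, (∑ a, v a * killingFn a x j) ^ 2) * η x ^ 2 := by
  have hint : ∀ a b, Integrable fun x : E3 ↦ v a * ((∑ j, killingFn a x j * killingFn b x j) * η x ^ 2) * v b :=
    fun a b ↦ ((integrable_killingFn_mul hη hηc a b).const_mul (v a)).mul_const (v b)
  simp only [dotProduct, Matrix.mulVec, gramMatrixK, Matrix.of_apply]
  have e1 : ∀ a, v a * ∑ b, (∫ x : E3, (∑ j, killingFn a x j * killingFn b x j) * η x ^ 2) * v b =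
      ∫ x : E3, ∑ b, v a * ((∑ j, killingFn a x j * killingFn b x j) * η x ^ 2) * v b := by
    intro a
    rw [integral_finsetSum _ fun b _ ↦ hint a b, Finset.mul_sum]
    refine Finset.sum_congr rfl fun b _ ↦ ?_
    rw [integral_mul_const, integral_const_mul]
    ring
  rw [Finset.sum_congr rfl fun a _ ↦ e1 a, ← integral_finsetSum _ fun a _ ↦
    integrable_finsetSum _ fun b _ ↦ hint a b]
  refine integral_congr_ae (ae_of_all _ fun x ↦ ?_)
  simp only
  have e2 : ∀ j, (∑ a, v a * killingFn a x j) ^ 2 * η x ^ 2 =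
      ∑ a, ∑ b, v a * (killingFn a x j * killingFn b x j * η x ^ 2) * v b := by
    intro j
    rw [sq (∑ a, v a * killingFn a x j), Finset.sum_mul_sum, Finset.sum_mul]
    refine Finset.sum_congr rfl fun a _ ↦ ?_
    rw [Finset.sum_mul]
    exact Finset.sum_congr rfl fun b _ ↦ by ring
  have e3 : ∀ a b, v a * ((∑ j, killingFn a x j * killingFn b x j) * η x ^ 2) * v b =
      ∑ j, v a * (killingFn a x j * killingFn b x j * η x ^ 2) * v b := fun a b ↦ by
    rw [Finset.sum_mul, Finset.mul_sum, Finset.sum_mul]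
  simp only [e3]
  rw [Finset.sum_mul]
  simp only [e2]
  conv_rhs => rw [Finset.sum_comm]
  refine Finset.sum_congr rfl fun a _ ↦ ?_
  exact Finset.sum_comm

/-- The Killing field with coefficients `v`: `U_j(x) = v_{inl j} + Σ_l v_{inr l} (Y_l)_j(x)`. [folklore] -/
theorem sum_killingFn_eq (v : Fin 3 ⊕ Fin 3 → ℝ) (x : E3) (j : Fin 3) :
    ∑ a, v a * killingFn a x j = v (Sum.inl j) + ∑ l, v (Sum.inr l) * rotGen l x j := by
  rw [Fintype.sum_sum_type]
  congr 1
  simp only [killingFn_inl, e, PiLp.single_apply, mul_ite, mul_one, mul_zero]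
  rw [Finset.sum_ite_eq]
  simp

/-- The rotation part `Σ_l ω_l (e_l × x)_j = (ω × x)_j` in coordinates. [folklore] -/
theorem sum_mul_rotGen_eq (w : Fin 3 → ℝ) (x : E3) (j : Fin 3) :
    ∑ l, w l * rotGen l x j =
      ![w 1 * x 2 - w 2 * x 1, w 2 * x 0 - w 0 * x 2, w 0 * x 1 - w 1 * x 0] j := by
  fin_cases j <;> simp [rotGen, e, PiLp.single_apply, Fin.sum_univ_three] <;> ring

/-- **A Killing field vanishing on a ball vanishes identically**: if `c + ω × x = 0` for all `x` in a ball then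
`c = 0` and `ω = 0`. [folklore] -/
theorem eq_zero_of_killing_eq_zero_on_ball {v : Fin 3 ⊕ Fin 3 → ℝ} {x₀ : E3} {ε : ℝ} (hε : 0 < ε)
    (h : ∀ x ∈ ball x₀ ε, ∀ j, ∑ a, v a * killingFn a x j = 0) : v = 0 := by
  set t : ℝ := ε / 2 with ht
  have ht0 : t ≠ 0 := by positivity
  have hmem : ∀ m, x₀ + t • e m ∈ ball x₀ ε := by
    intro m
    rw [mem_ball, dist_eq_norm, add_sub_cancel_left, norm_smul, Real.norm_eq_abs,
      show ‖e m‖ = 1 by simp [e], mul_one, abs_of_pos (by positivity : 0 < t)]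
    linarith
  -- differences along the axes isolate `ω × e_m`
  have hdiff : ∀ m j, t * ∑ l, v (Sum.inr l) * rotGen l (e m) j = 0 := by
    intro m j
    have h1 := h _ (hmem m) j
    have h0 := h x₀ (mem_ball_self hε) j
    rw [sum_killingFn_eq] at h1 h0
    have e1 : ∑ l, v (Sum.inr l) * rotGen l (x₀ + t • e m) j =
        (∑ l, v (Sum.inr l) * rotGen l x₀ j) + t * ∑ l, v (Sum.inr l) * rotGen l (e m) j := by
      rw [Finset.mul_sum, ← Finset.sum_add_distrib]
      refine Finset.sum_congr rfl fun l _ ↦ ?_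
      rw [rotGen_add, rotGen_smul]
      ring
    rw [e1] at h1
    linarith
  have hω : ∀ l, v (Sum.inr l) = 0 := by
    have k := fun m j ↦ (mul_eq_zero.1 (hdiff m j)).resolve_left ht0
    have k12 := k 1 2; have k20 := k 2 0; have k01 := k 0 1
    rw [sum_mul_rotGen_eq] at k12 k20 k01
    simp [e] at k12 k20 k01
    intro l
    fin_cases l
    · simpa using k12
    · simpa using k20
    · simpa using k01
  have hc : ∀ j, v (Sum.inl j) = 0 := by
    intro j
    have h0 := h x₀ (mem_ball_self hε) j
    rw [sum_killingFn_eq] at h0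
    simpa [hω] using h0
  funext a
  cases a with
  | inl j => exact hc j
  | inr l => exact hω l

/-- **The Gram matrix of the Killing fields is positive definite** for a continuous compactly supported `η ≢ 0`.
[cite: MaoOhTao2023, Lemma 2.2 (proof)] -/
theorem gramMatrixK_posDef (hη : Continuous η) (hηc : HasCompactSupport η) {x₀ : E3} (hx₀ : η x₀ ≠ 0) :
    (gramMatrixK η).PosDef := by
  rw [Matrix.posDef_iff_dotProduct_mulVec]
  refine ⟨?_, fun v hv ↦ ?_⟩
  · show (gramMatrixK η)ᴴ = gramMatrixK η
    rw [Matrix.conjTranspose_eq_transpose_of_trivial, gramMatrixK_transpose]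
  rw [star_trivial, dotProduct_gramMatrixK_mulVec hη hηc]
  set F : E3 → ℝ := fun x ↦ (∑ j, (∑ a, v a * killingFn a x j) ^ 2) * η x ^ 2 with hF
  have hFc : Continuous F := (continuous_finsetSum _ fun j _ ↦ (continuous_finsetSum _ fun a _ ↦
    continuous_const.mul (continuous_killingFn a j)).pow 2).mul (hη.pow 2)
  have hFs : HasCompactSupport F := hasCompactSupport_of_eta hηc fun x hx ↦ by simp [hF, hx]
  have hF0 : 0 ≤ F := fun x ↦ mul_nonneg (Finset.sum_nonneg fun j _ ↦ sq_nonneg _) (sq_nonneg _)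
  obtain ⟨ε, hε, hball⟩ : ∃ ε > 0, ∀ x ∈ ball x₀ ε, η x ≠ 0 := by
    have hopen : IsOpen {x : E3 | η x ≠ 0} := isOpen_ne_fun hη continuous_const
    obtain ⟨ε, hε, hsub⟩ := Metric.isOpen_iff.1 hopen x₀ hx₀
    exact ⟨ε, hε, fun x hx ↦ hsub hx⟩
  have hex : ∃ x₁ ∈ ball x₀ ε, ∃ j, ∑ a, v a * killingFn a x₁ j ≠ 0 := by
    by_contra hcon
    push Not at hcon
    exact hv (eq_zero_of_killing_eq_zero_on_ball hε hcon)
  obtain ⟨x₁, hx₁, j, hj⟩ := hex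
  have hFx : F x₁ ≠ 0 := by
    refine mul_ne_zero (ne_of_gt ?_) (pow_ne_zero 2 (hball x₁ hx₁))
    refine lt_of_lt_of_le (by positivity : (0 : ℝ) < (∑ a, v a * killingFn a x₁ j) ^ 2) ?_
    exact Finset.single_le_sum (f := fun j ↦ (∑ a, v a * killingFn a x₁ j) ^ 2) (fun j _ ↦ sq_nonneg _)
      (Finset.mem_univ j)
  exact hFc.integral_pos_of_hasCompactSupport_nonneg_nonzero hFs hF0 hFx

/-- The Gram matrix of the Killing fields is invertible. [cite: MaoOhTao2023, Lemma 2.2 (proof)] -/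
theorem isUnit_gramMatrixK_det (hη : Continuous η) (hηc : HasCompactSupport η) {x₀ : E3} (hx₀ : η x₀ ≠ 0) :
    IsUnit (gramMatrixK η).det :=
  (Matrix.isUnit_iff_isUnit_det _).1 (gramMatrixK_posDef hη hηc hx₀).isUnit

/-! ### The dual bump fields `θ^a` -/

/-- **The dual bump fields** `(θ^a)_j = Σ_b (G⁻¹)_{ab} (K_b)_j η²`. [cite: MaoOhTao2023, Lemma 2.2 (proof)] -/
def thetaK (η : E3 → ℝ) (a : Fin 3 ⊕ Fin 3) (x : E3) (j : Fin 3) : ℝ :=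
  ∑ b, (gramMatrixK η)⁻¹ a b * killingFn b x j * η x ^ 2

/-- `θ^a` vanishes where `η` does. [folklore] -/
theorem thetaK_eq_zero_of_eta (η : E3 → ℝ) (a : Fin 3 ⊕ Fin 3) {x : E3} (hx : η x = 0) (j : Fin 3) :
    thetaK η a x j = 0 := by
  simp [thetaK, hx]

/-- `θ^a` is continuous. [folklore] -/
theorem continuous_thetaK (hη : Continuous η) (a : Fin 3 ⊕ Fin 3) (j : Fin 3) :
    Continuous fun x ↦ thetaK η a x j :=
  continuous_finsetSum _ fun b _ ↦ (continuous_const.mul (continuous_killingFn b j)).mul (hη.pow 2)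

/-- `θ^a` is as smooth as `η`. [folklore] -/
theorem contDiff_thetaK {n : ℕ∞ω} (hη : ContDiff ℝ n η) (a : Fin 3 ⊕ Fin 3) (j : Fin 3) :
    ContDiff ℝ n fun x ↦ thetaK η a x j :=
  ContDiff.sum fun b _ ↦ (contDiff_const.mul (contDiff_killingFn b j)).mul (hη.pow 2)

/-- `θ^a` has compact support. [folklore] -/
theorem hasCompactSupport_thetaK (hηc : HasCompactSupport η) (a : Fin 3 ⊕ Fin 3) (j : Fin 3) :
    HasCompactSupport fun x ↦ thetaK η a x j :=
  hasCompactSupport_of_eta hηc fun _ hx ↦ thetaK_eq_zero_of_eta η a hx j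

/-- The topological support of `θ^a` lies in that of `η`. [folklore] -/
theorem tsupport_thetaK_subset (η : E3 → ℝ) (a : Fin 3 ⊕ Fin 3) (j : Fin 3) :
    tsupport (fun x ↦ thetaK η a x j) ⊆ tsupport η :=
  closure_mono (support_subset_iff'.2 fun _ hx ↦ thetaK_eq_zero_of_eta η a (notMem_support.1 hx) j)

/-- **Biorthogonality**: `∫ θ^a · K_{a'} dx = δ^a_{a'}`. [cite: MaoOhTao2023, Lemma 2.2 (proof)] -/
theorem integral_thetaK_killingFn (hη : Continuous η) (hηc : HasCompactSupport η) {x₀ : E3} (hx₀ : η x₀ ≠ 0)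
    (a a' : Fin 3 ⊕ Fin 3) :
    ∫ x : E3, ∑ j, thetaK η a x j * killingFn a' x j = if a = a' then 1 else 0 := by
  have hint : ∀ b, Integrable fun x : E3 ↦
      (gramMatrixK η)⁻¹ a b * ((∑ j, killingFn b x j * killingFn a' x j) * η x ^ 2) :=
    fun b ↦ (integrable_killingFn_mul hη hηc b a').const_mul _
  have e1 : (fun x : E3 ↦ ∑ j, thetaK η a x j * killingFn a' x j) =
      fun x ↦ ∑ b, (gramMatrixK η)⁻¹ a b * ((∑ j, killingFn b x j * killingFn a' x j) * η x ^ 2) := by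
    funext x
    simp only [thetaK, Finset.sum_mul]
    rw [Finset.sum_comm]
    refine Finset.sum_congr rfl fun b _ ↦ ?_
    rw [Finset.mul_sum]
    exact Finset.sum_congr rfl fun j _ ↦ by ring
  rw [e1, integral_finsetSum _ fun b _ ↦ hint b]
  simp only [integral_const_mul, ← gramMatrixK_apply]
  have h := Matrix.nonsing_inv_mul (gramMatrixK η) (isUnit_gramMatrixK_det hη hηc hx₀)
  have h' := congr_fun (congr_fun h a) a'
  rw [Matrix.mul_apply, Matrix.one_apply] at h'
  exact h'

/-! ### The moment-corrected localisation of a vector density -/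

/-- **The moment-corrected localisation** `(F_k)_j = F_j χ_k − Σ_a (∫ (F χ_k)·K_a) (θ^a)_j` of a vector density `F`
by a cut-off `χ_k`. [cite: MaoOhTao2023, Lemma 2.2 (proof)] -/
def momentPartK (η : E3 → ℝ) (F : Fin 3 → E3 → ℝ) (χ : E3 → ℝ) (j : Fin 3) (x : E3) : ℝ :=
  F j x * χ x - ∑ a, (∫ y : E3, ∑ i, F i y * χ y * killingFn a y i) * thetaK η a x j

variable {F : Fin 3 → E3 → ℝ} {χ : E3 → ℝ}

/-- `F_k` vanishes where `F χ_k` (all components) and `η` do. [folklore] -/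
theorem momentPartK_eq_zero (η : E3 → ℝ) (F : Fin 3 → E3 → ℝ) {χ : E3 → ℝ} {x : E3} {j : Fin 3}
    (hχ : F j x * χ x = 0) (hηx : η x = 0) : momentPartK η F χ j x = 0 := by
  simp [momentPartK, hχ, thetaK_eq_zero_of_eta η _ hηx]

/-- Support: `supp (F_k)_j ⊆ supp (F_j χ_k) ∪ supp η`. [folklore] -/
theorem support_momentPartK_subset (η : E3 → ℝ) (F : Fin 3 → E3 → ℝ) (χ : E3 → ℝ) (j : Fin 3) :
    support (momentPartK η F χ j) ⊆ support (fun x ↦ F j x * χ x) ∪ support η := by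
  intro x hx
  by_contra h
  rw [mem_union, not_or, notMem_support, notMem_support] at h
  exact hx (momentPartK_eq_zero η F h.1 h.2)

/-- Topological support: `tsupp (F_k)_j ⊆ U` when `tsupp (F_j χ_k), tsupp η ⊆ U`. [folklore] -/
theorem tsupport_momentPartK_subset {U : Set E3} {j : Fin 3} (hχU : tsupport (fun x ↦ F j x * χ x) ⊆ U)
    (hηU : tsupport η ⊆ U) : tsupport (momentPartK η F χ j) ⊆ U := by
  refine (closure_mono (support_momentPartK_subset η F χ j)).trans ?_
  rw [closure_union]
  exact union_subset hχU hηU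

/-- `F_k` is continuous for continuous data. [folklore] -/
theorem continuous_momentPartK (hη : Continuous η) (hF : ∀ j, Continuous (F j)) (hχ : Continuous χ) (j : Fin 3) :
    Continuous (momentPartK η F χ j) :=
  ((hF j).mul hχ).sub (continuous_finsetSum _ fun a _ ↦ continuous_const.mul (continuous_thetaK hη a j))

/-- `F_k` has compact support when `F` and `η` do. [folklore] -/
theorem hasCompactSupport_momentPartK (hηc : HasCompactSupport η) (hFc : ∀ j, HasCompactSupport (F j))
    (χ : E3 → ℝ) (j : Fin 3) : HasCompactSupport (momentPartK η F χ j) := by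
  refine HasCompactSupport.intro ((hFc j).union hηc) fun x hx ↦ ?_
  rw [mem_union, not_or] at hx
  have hF0 : F j x = 0 := image_eq_zero_of_notMem_tsupport hx.1
  have hη0 : η x = 0 := image_eq_zero_of_notMem_tsupport hx.2
  exact momentPartK_eq_zero η F (by rw [hF0, zero_mul]) hη0

/-- The localised Killing moments converge for `F ∈ C_c`, `χ ∈ C`. [folklore] -/
theorem integrable_sum_mul_mul_killingFn (hF : ∀ j, Continuous (F j)) (hFc : ∀ j, HasCompactSupport (F j))
    (hχ : Continuous χ) (a : Fin 3 ⊕ Fin 3) :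
    Integrable fun y : E3 ↦ ∑ i, F i y * χ y * killingFn a y i :=
  integrable_finsetSum _ fun i _ ↦ (((hF i).mul hχ).mul (continuous_killingFn a i)).integrable_of_hasCompactSupport
    ((hFc i).mul_right.mul_right)

/-- **The Killing moments of `F_k` vanish**: `∫ F_k · K_{a'} dx = 0`. [cite: MaoOhTao2023, Lemma 2.2 (proof)] -/
theorem integral_momentPartK_killingFn (hη : Continuous η) (hηc : HasCompactSupport η) {x₀ : E3}
    (hx₀ : η x₀ ≠ 0) (hF : ∀ j, Continuous (F j)) (hFc : ∀ j, HasCompactSupport (F j)) (hχ : Continuous χ)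
    (a' : Fin 3 ⊕ Fin 3) :
    ∫ x : E3, ∑ j, momentPartK η F χ j x * killingFn a' x j = 0 := by
  have h1 : Integrable fun x : E3 ↦ ∑ j, F j x * χ x * killingFn a' x j :=
    integrable_sum_mul_mul_killingFn hF hFc hχ a'
  have hθ : ∀ a, Integrable fun x : E3 ↦ ∑ j, thetaK η a x j * killingFn a' x j := fun a ↦
    integrable_finsetSum _ fun j _ ↦ ((continuous_thetaK hη a j).mul
      (continuous_killingFn a' j)).integrable_of_hasCompactSupport (hasCompactSupport_thetaK hηc a j).mul_right
  have h2 : ∀ a, Integrable fun x : E3 ↦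
      (∫ y : E3, ∑ i, F i y * χ y * killingFn a y i) * ∑ j, thetaK η a x j * killingFn a' x j :=
    fun a ↦ (hθ a).const_mul _
  have e1 : (fun x : E3 ↦ ∑ j, momentPartK η F χ j x * killingFn a' x j) = fun x ↦
      (∑ j, F j x * χ x * killingFn a' x j) -
        ∑ a, (∫ y : E3, ∑ i, F i y * χ y * killingFn a y i) * ∑ j, thetaK η a x j * killingFn a' x j := by
    funext x
    simp only [momentPartK, sub_mul, Finset.sum_sub_distrib, Finset.sum_mul, Finset.mul_sum]
    congr 1
    rw [Finset.sum_comm]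
    exact Finset.sum_congr rfl fun a _ ↦ Finset.sum_congr rfl fun j _ ↦ by ring
  rw [e1, integral_sub h1 (integrable_finsetSum _ fun a _ ↦ h2 a), integral_finsetSum _ fun a _ ↦ h2 a]
  simp only [integral_const_mul, integral_thetaK_killingFn hη hηc hx₀, mul_ite, mul_one, mul_zero,
    Finset.sum_ite_eq', Finset.mem_univ, if_true, sub_self]

/-- **The decomposition identity**: if `χ₁ + χ₂ = 1` wherever some component of `F` is non-zero, then
`F₁ + F₂ = F − Σ_a (∫ F·K_a) θ^a`. [cite: MaoOhTao2023, Lemma 2.2 (proof)] -/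
theorem momentPartK_add_momentPartK (hF : ∀ j, Continuous (F j)) (hFc : ∀ j, HasCompactSupport (F j))
    {χ₁ χ₂ : E3 → ℝ} (hχ₁ : Continuous χ₁) (hχ₂ : Continuous χ₂)
    (hsum : ∀ x, (∃ j, F j x ≠ 0) → χ₁ x + χ₂ x = 1) (j : Fin 3) (x : E3) :
    momentPartK η F χ₁ j x + momentPartK η F χ₂ j x =
      F j x - ∑ a, (∫ y : E3, ∑ i, F i y * killingFn a y i) * thetaK η a x j := by
  have hpt : ∀ i y, F i y * χ₁ y + F i y * χ₂ y = F i y := by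
    intro i y
    by_cases hy : F i y = 0
    · simp [hy]
    · rw [← mul_add, hsum y ⟨i, hy⟩, mul_one]
  have hI : ∀ (χ : E3 → ℝ), Continuous χ → ∀ a i, Integrable fun y : E3 ↦ F i y * χ y * killingFn a y i :=
    fun χ hχ a i ↦ (((hF i).mul hχ).mul (continuous_killingFn a i)).integrable_of_hasCompactSupport
      ((hFc i).mul_right.mul_right)
  have hmom : ∀ a, (∫ y : E3, ∑ i, F i y * χ₁ y * killingFn a y i) + ∫ y : E3, ∑ i, F i y * χ₂ y * killingFn a y i =
      ∫ y : E3, ∑ i, F i y * killingFn a y i := by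
    intro a
    rw [← integral_add (integrable_finsetSum _ fun i _ ↦ hI χ₁ hχ₁ a i)
      (integrable_finsetSum _ fun i _ ↦ hI χ₂ hχ₂ a i)]
    refine integral_congr_ae (ae_of_all _ fun y ↦ ?_)
    simp only
    rw [← Finset.sum_add_distrib]
    exact Finset.sum_congr rfl fun i _ ↦ by rw [← add_mul, hpt i y]
  simp only [momentPartK]
  rw [show ∑ a, (∫ y : E3, ∑ i, F i y * killingFn a y i) * thetaK η a x j =
      ∑ a, ((∫ y : E3, ∑ i, F i y * χ₁ y * killingFn a y i) +
        ∫ y : E3, ∑ i, F i y * χ₂ y * killingFn a y i) * thetaK η a x j from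
    Finset.sum_congr rfl fun a _ ↦ by rw [hmom a]]
  simp only [add_mul, Finset.sum_add_distrib]
  linarith [hpt j x]

/-- **`F = F₁ + F₂` under the Killing moment conditions** `∫ F·e_l = ∫ F·Y_l = 0`.
[cite: MaoOhTao2023, Lemma 2.2 (proof)] -/
theorem momentPartK_add_momentPartK_of_moments (hF : ∀ j, Continuous (F j)) (hFc : ∀ j, HasCompactSupport (F j))
    {χ₁ χ₂ : E3 → ℝ} (hχ₁ : Continuous χ₁) (hχ₂ : Continuous χ₂)
    (hsum : ∀ x, (∃ j, F j x ≠ 0) → χ₁ x + χ₂ x = 1)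
    (hmom : ∀ a, ∫ y : E3, ∑ i, F i y * killingFn a y i = 0) (j : Fin 3) (x : E3) :
    momentPartK η F χ₁ j x + momentPartK η F χ₂ j x = F j x := by
  rw [momentPartK_add_momentPartK hF hFc hχ₁ hχ₂ hsum j x]
  simp [hmom]

/-- **Conversely**, `F = F₁ + F₂` forces the Killing moment conditions. [cite: MaoOhTao2023, Lemma 2.2 (proof)] -/
theorem momentsK_of_momentPartK_add (hη : Continuous η) (hηc : HasCompactSupport η) {x₀ : E3}
    (hx₀ : η x₀ ≠ 0) (hF : ∀ j, Continuous (F j)) (hFc : ∀ j, HasCompactSupport (F j)) {χ₁ χ₂ : E3 → ℝ}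
    (hχ₁ : Continuous χ₁) (hχ₂ : Continuous χ₂)
    (hdec : ∀ j x, momentPartK η F χ₁ j x + momentPartK η F χ₂ j x = F j x) (a' : Fin 3 ⊕ Fin 3) :
    ∫ y : E3, ∑ j, F j y * killingFn a' y j = 0 := by
  have hI : ∀ (χ : E3 → ℝ), Continuous χ →
      Integrable fun x : E3 ↦ ∑ j, momentPartK η F χ j x * killingFn a' x j := fun χ hχ ↦
    integrable_finsetSum _ fun j _ ↦ ((continuous_momentPartK hη hF hχ j).mul
      (continuous_killingFn a' j)).integrable_of_hasCompactSupport (hasCompactSupport_momentPartK hηc hFc χ j).mul_right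
  calc ∫ y : E3, ∑ j, F j y * killingFn a' y j
      = ∫ y : E3, ((∑ j, momentPartK η F χ₁ j y * killingFn a' y j) +
          ∑ j, momentPartK η F χ₂ j y * killingFn a' y j) := by
        refine integral_congr_ae (ae_of_all _ fun y ↦ ?_)
        simp only
        rw [← Finset.sum_add_distrib]
        exact Finset.sum_congr rfl fun j _ ↦ by rw [← add_mul, hdec j y]
    _ = 0 := by
        rw [integral_add (hI χ₁ hχ₁) (hI χ₂ hχ₂), integral_momentPartK_killingFn hη hηc hx₀ hF hFc hχ₁,
          integral_momentPartK_killingFn hη hηc hx₀ hF hFc hχ₂, add_zero]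

end MaoOhTao

end Literature.Geometry.Lorentzian

end
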